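import Mathlib
import Summits.CriticalPhenomena.Ising3DConformalLimit.Theses.PerfectScreening

/-!
# Sketch — crux-ideate round 1, ideator 2, crux `SubharmonicOffOrigin` (stmt-CriticalPhenomena-1341)

First lemmas of the two idea cards (statements only; `sorry` allowed at this stage):

* card `direct-correlation-shells` : L0 (the precision identity for ν), L1 (inverse-M kernel ⇒ SubH at
  the six nearest neighbours), L2 (inverse-M kernel ∧ long-range superharmonicity ⇒ the crux).
* card `mirror-mean-lsc` : M1 (axial SubH from the measure inequality "mean-LSC" between two Hausdorff
  moment measures of support item 13893), M2 (mean-LSC is automatic on `[0, 5 - 2√6]`).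
-/

namespace Summit.CriticalPhenomena.Ising3DConformalLimit.Cruxes.SubharmonicOffOrigin.Ideator2

open Literature.Probability.LatticeModels MeasureTheory
open scoped BigOperators Classical

/-- The critical two-point function `G = ⟨σ₀σ_x⟩⁺_{β_c(3)}` on `ℤ³`. -/
noncomputable abbrev G : Site 3 → ℝ := criticalTwoPoint 3

/-- Unit lattice steps `±eᵢ`. -/
def IsUnitStep (y : Site 3) : Prop := ∃ i : Fin 3, y = Pi.single i 1 ∨ y = -Pi.single i 1

/-- The lattice Laplacian of `G` at `x` in the crux's normal form: `Σᵢ (G(x+eᵢ)+G(x−eᵢ)) − 6 G(x)`. -/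
noncomputable def nu (x : Site 3) : ℝ :=
  (∑ i : Fin 3, (G (x + Pi.single i 1) + G (x - Pi.single i 1))) - 6 * G x

/-- The long-range part of the precision kernel acting on `G` ("orbit-mean defect"):
`R a x = Σ_{y ≠ 0, y not a unit step} a(y) (G x − G (x − y))`. -/
noncomputable def R (a : Site 3 → ℝ) (x : Site 3) : ℝ :=
  ∑' y : Site 3, (if y = 0 ∨ IsUnitStep y then 0 else a y * (G x - G (x - y)))

/-- **Inverse-M kernel form of the critical precision** (the infinite-volume content of
`PrecisionLaplacian.InverseMFerromagnet` + its support `InverseMCriticalKernel`, written out):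
a nonnegative summable even cubic-symmetric kernel `a` with `a 0 = 0`, positive on unit steps and
constant there, for which `G` is harmonic off the origin for the conservative Laplacian with rates
`a` (zero row sum = criticality, `χ = ∞`). -/
structure InverseMKernel (a : Site 3 → ℝ) : Prop where
  nonneg : ∀ y, 0 ≤ a y
  zero : a 0 = 0
  summable : Summable a
  unit : ∀ y, IsUnitStep y → a y = a (Pi.single 0 1)
  unit_pos : 0 < a (Pi.single 0 1)
  absConv : ∀ x : Site 3, Summable fun y => a y * (G x - G (x - y))
  harmonic : ∀ x : Site 3, x ≠ 0 → ∑' y, a y * (G x - G (x - y)) = 0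

/-- **L0 (identity).** Under the kernel form, the screening charge is the long-range part of the
precision acting on `G`: `a(e₁) · ν(x) = R a x` for `x ≠ 0`. -/
theorem nu_eq_longRange (a : Site 3 → ℝ) (h : InverseMKernel a) (x : Site 3) (hx : x ≠ 0) :
    a (Pi.single 0 1) * nu x = R a x := by
  sorry

/-- **L1 (theorem-shape, the razor-thin site).** Inverse-M kernel form ⇒ SubH at the nearest
neighbour `e₀` (hence at all six, by lattice symmetry): every term of `R a e₀` is `≥ 0` because
`G (e₀ − y) ≤ max_{z ≠ 0} G = G e₀` (Messager–Miracle-Solé / Schrader maximality, tree: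
`twoPointPlus_le_axis_of_mem_sphere`, `criticalTwoPoint_axis_succ_le`) and `e₀ − y ≠ 0` for
non-unit `y`. -/
theorem subH_nearestNeighbour_of_inverseM (a : Site 3 → ℝ) (h : InverseMKernel a)
    (hmax : ∀ z : Site 3, z ≠ 0 → G z ≤ G (Pi.single 0 1)) :
    6 * G (Pi.single 0 1) ≤
      ∑ i : Fin 3, (G (Pi.single 0 1 + Pi.single i 1) + G (Pi.single 0 1 - Pi.single i 1)) := by
  -- every term of `R a e₀` is nonnegative (MMS maximality), so `a(e₀) ν(e₀) = R a e₀ ≥ 0`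
  have hR : 0 ≤ R a (Pi.single 0 1) := by
    unfold R
    refine tsum_nonneg fun y => ?_
    split_ifs with hy
    · exact le_refl _
    · push_neg at hy
      have hne : (Pi.single (0 : Fin 3) (1 : ℤ) : Site 3) - y ≠ 0 := by
        intro h0
        apply hy.2
        refine ⟨0, Or.inl ?_⟩
        exact (sub_eq_zero.mp h0).symm
      exact mul_nonneg (h.nonneg y) (sub_nonneg.mpr (hmax _ hne))
  have hid := nu_eq_longRange a h (Pi.single 0 1) (by simp)
  have hν : 0 ≤ nu (Pi.single 0 1) := by
    have : 0 ≤ a (Pi.single 0 1) * nu (Pi.single 0 1) := hid ▸ hR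
    exact nonneg_of_mul_nonneg_right (by simpa [mul_comm] using this) h.unit_pos
  unfold nu at hν
  linarith

/-- **L2 (composition).** Inverse-M kernel form ∧ long-range superharmonicity of `G` beyond the
first shell ⇒ the crux, literally. -/
theorem subharmonicOffOrigin_of_inverseM_of_lrSuper (a : Site 3 → ℝ) (h : InverseMKernel a)
    (hmax : ∀ z : Site 3, z ≠ 0 → G z ≤ G (Pi.single 0 1))
    (hLR : ∀ x : Site 3, x ≠ 0 → ¬ IsUnitStep x → 0 ≤ R a x) :
    Summit.CriticalPhenomena.Ising3DConformalLimit.Theses.PerfectScreening.SubharmonicOffOrigin := by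
  sorry

/-! ### Card `mirror-mean-lsc` -/

/-- The axial site `(n, 0, 0)` and its first transverse neighbour `(n, 1, 0)`. -/
def axial (n : ℕ) : Site 3 := Fin.cons (n : ℤ) 0
def axialT (n : ℕ) : Site 3 := Fin.cons (n : ℤ) (Pi.single 0 1)

/-- **M1.** Axial SubH from "mean-LSC" in quadratic-form language. `μ₀` = the Hausdorff moment
measure of `n ↦ G(n,0,0)` and `μ₁` = that of `n ↦ 2(G(n,0,0) − G(n,1,0))` (support item 13893 =
`MixedSpectralRepresentation` with `v = δ₀` and `v = δ₀ − δ_{e}` on `s = {0, e}`); if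
`2t·μ₁ ≤ (1−t)²·μ₀` as measures on `(0,1]` then `ν(n,0,0) ≥ 0` for all `n ≥ 1`
(`ν(n,0,0) = ∫ t^{n-1}(1-t)² dμ₀ − 2∫ tⁿ dμ₁`). -/
theorem axial_subH_of_meanLSC (μ₀ μ₁ : Measure ℝ) [IsFiniteMeasure μ₀] [IsFiniteMeasure μ₁]
    (hs0 : μ₀ (Set.Icc (0:ℝ) 1)ᶜ = 0) (hs1 : μ₁ (Set.Icc (0:ℝ) 1)ᶜ = 0)
    (hG0 : ∀ n : ℕ, G (axial n) = ∫ t, t ^ n ∂μ₀)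
    (hG1 : ∀ n : ℕ, 2 * (G (axial n) - G (axialT n)) = ∫ t, t ^ n ∂μ₁)
    (hLSC : ∀ B : Set ℝ, MeasurableSet B →
      2 * ∫ t in B, t ∂μ₁ ≤ ∫ t in B, (1 - t) ^ 2 ∂μ₀) :
    ∀ n : ℕ, 1 ≤ n → 0 ≤ nu (axial n) := by
  sorry

/-- **M2 (free high-energy slices).** With `μ₊` the moment measure of `n ↦ 2(G(n,0,0)+G(n,1,0))`,
the parallelogram law `μ₁ + μ₊ = 4μ₀` gives `μ₁ ≤ 4μ₀`, hence mean-LSC holds automatically on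
`[0, 5 − 2√6]` (`8t ≤ (1−t)²` iff `t ≤ 5 − 2√6 ≈ 0.101`, i.e. energies `E ≥ arccosh 5`). -/
theorem meanLSC_below_threshold (μ₀ μ₁ μp : Measure ℝ) [IsFiniteMeasure μ₀] [IsFiniteMeasure μ₁]
    [IsFiniteMeasure μp] (hpar : μ₁ + μp = (4 : ENNReal) • μ₀)
    (B : Set ℝ) (hB : MeasurableSet B) (hBt : B ⊆ Set.Icc 0 (5 - 2 * Real.sqrt 6)) :
    2 * ∫ t in B, t ∂μ₁ ≤ ∫ t in B, (1 - t) ^ 2 ∂μ₀ := by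
  sorry

end Summit.CriticalPhenomena.Ising3DConformalLimit.Cruxes.SubharmonicOffOrigin.Ideator2
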